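import Mathlib

/-!
# Crux `RigidityForcesSymmetry.RigidMinimalRepr` (stmt-ValiantsHypothesis-4163), line `registered` —
# stub `stub_eigenbasis` (simple spectrum with `dim V` present weights gives a weight-indexed eigenbasis)

Route `ValiantsHypothesis/RigidityForcesSymmetry`, crux `RigidMinimalRepr`, skeleton
`Cruxes/RigidMinimalRepr/Lines/registered.lean`, stub `stub_eigenbasis` (first step of the graded normal form in
the tight case `n = 2 ^ m - 1` of the torus bound).

**Statement.** Let `B` be an endomorphism of a finite-dimensional complex vector space `V` and `wt : ι → ℂ` an
injective family of `dim V` scalars all of whose generalised eigenspaces `⨆ₖ ker (B - wt i)ᵏ` are non-zero.  Then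
`V` has a basis `b` indexed by `ι` with `B (b i) = wt i • b i`, and every generalised eigenvector of `B` for a
scalar `μ` has `b`-coordinates supported on `{i | wt i = μ}`.

**Proof.** Pick `v i ≠ 0` in the generalised eigenspace of `wt i`.  The generalised eigenspaces of `B` form an
independent family (`Module.End.independent_maxGenEigenspace`), so `v` is linearly independent
(`iSupIndep.linearIndependent`) and, having `dim V` members, is a basis `b`.  If `x` lies in the generalised
eigenspace of `μ`, subtracting its components along the `b i` with `wt i = μ` leaves a vector lying both in that
space and in the supremum of the other generalised eigenspaces, hence zero by independence; linear independence
of `b` then kills every coordinate `b.repr x i` with `wt i ≠ μ`.  Applied to `x = B (b i)` (generalised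
eigenspaces are `B`-stable) this gives `B (b i) = a • b i` with `a = b.repr (B (b i)) i`, and applied to the
eigenvector `b i ∈ ker (B - a)` it gives `a = wt i`.
-/

set_option autoImplicit false

-- the mandated summit-side namespace repeats a component by design (single-problem summit)
set_option linter.dupNamespace false

open Module.End

namespace Summit.ValiantsHypothesis.ValiantsHypothesis.Theorems.RigidityForcesSymmetryRigidMinimalRepr

/-- **Weight support of generalised eigenvectors.** If `b` is a basis of `V` with `b i` in the generalised
eigenspace of `B` for `wt i`, then every `x` in the generalised eigenspace of `B` for `μ` has `b.repr x i = 0`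
whenever `wt i ≠ μ`. -/
theorem eigenbasis_repr_eq_zero {V : Type*} [AddCommGroup V] [Module ℂ V]
    (B : Module.End ℂ V) {ι : Type*} [Fintype ι] (wt : ι → ℂ) (b : Module.Basis ι ℂ V)
    (hbv : ∀ i, b i ∈ B.maxGenEigenspace (wt i)) (μ : ℂ) (x : V) (hx : x ∈ B.maxGenEigenspace μ)
    (i : ι) (hi : wt i ≠ μ) : b.repr x i = 0 := by
  classical
  -- the coordinates of `x` off the weight `μ`
  set g : ι → ℂ := fun j => if wt j = μ then 0 else b.repr x j with hg
  have hsum : ∑ j, g j • b j = x - ∑ j, (if wt j = μ then b.repr x j else 0) • b j := by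
    rw [eq_sub_iff_add_eq, ← Finset.sum_add_distrib]
    conv_rhs => rw [← b.sum_repr x]
    refine Finset.sum_congr rfl fun j _ => ?_
    rw [← add_smul]
    congr 1
    simp only [hg]
    split_ifs <;> simp
  have h1 : ∑ j, g j • b j ∈ B.maxGenEigenspace μ := by
    rw [hsum]
    refine Submodule.sub_mem _ hx (Submodule.sum_mem _ fun j _ => ?_)
    split_ifs with h
    · rw [← h]
      exact Submodule.smul_mem _ _ (hbv j)
    · rw [zero_smul]
      exact Submodule.zero_mem _
  have h2 : ∑ j, g j • b j ∈ ⨆ (μ' : ℂ) (_ : μ' ≠ μ), B.maxGenEigenspace μ' := by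
    refine Submodule.sum_mem _ fun j _ => ?_
    simp only [hg]
    split_ifs with h
    · rw [zero_smul]
      exact Submodule.zero_mem _
    · exact Submodule.smul_mem _ _
        (Submodule.mem_iSup_of_mem (wt j) (Submodule.mem_iSup_of_mem h (hbv j)))
  have h0 : ∑ j, g j • b j = 0 :=
    Submodule.disjoint_def.mp (B.independent_maxGenEigenspace μ) _ h1 h2
  have := Fintype.linearIndependent_iff.mp b.linearIndependent g h0 i
  simpa [hg, hi] using this

/-- **Stub `stub_eigenbasis` of line `registered` for crux `RigidMinimalRepr`.** An endomorphism `B` of a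
finite-dimensional complex vector space with `dim V` pairwise distinct scalars `wt i` all having non-zero
generalised eigenspace admits an eigenbasis `b` indexed by the weights, `B (b i) = wt i • b i`, and every
generalised eigenvector for `μ` has `b`-coordinates supported on the indices of weight `μ`. -/
theorem stub_eigenbasis {V : Type*} [AddCommGroup V] [Module ℂ V] [FiniteDimensional ℂ V]
    (B : Module.End ℂ V) {ι : Type*} [Fintype ι] (wt : ι → ℂ) (hwt : Function.Injective wt)
    (hne : ∀ i, B.maxGenEigenspace (wt i) ≠ ⊥) (hcard : Fintype.card ι = Module.finrank ℂ V) :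
    ∃ b : Module.Basis ι ℂ V, (∀ i, B (b i) = wt i • b i) ∧
      ∀ (μ : ℂ) (v : V), v ∈ B.maxGenEigenspace μ → ∀ i, b.repr v i ≠ 0 → μ = wt i := by
  classical
  -- a non-zero generalised eigenvector for each weight
  have hex : ∀ i, ∃ x : V, x ∈ B.maxGenEigenspace (wt i) ∧ x ≠ 0 := fun i =>
    Submodule.exists_mem_ne_zero_of_ne_bot (hne i)
  choose v hv hv0 using hex
  -- they are linearly independent, hence a basis
  have hind : iSupIndep fun i => B.maxGenEigenspace (wt i) :=
    B.independent_maxGenEigenspace.comp hwt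
  have hli : LinearIndependent ℂ v := hind.linearIndependent _ hv hv0
  set b : Module.Basis ι ℂ V := basisOfLinearIndependentOfCardEqFinrank' v hli hcard
  have hb : ⇑b = v := coe_basisOfLinearIndependentOfCardEqFinrank' _ _ _
  have hbv : ∀ i, b i ∈ B.maxGenEigenspace (wt i) := fun i => by
    rw [hb]
    exact hv i
  have key := eigenbasis_repr_eq_zero B wt b hbv
  refine ⟨b, fun i => ?_, fun μ x hx i hi => ?_⟩
  · -- `B (b i)` is again a generalised eigenvector for `wt i`, so it is a multiple of `b i`
    have hBb : B (b i) ∈ B.maxGenEigenspace (wt i) :=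
      B.mapsTo_maxGenEigenspace_of_comm (Commute.refl B) (wt i) (hbv i)
    have hrepr : ∀ j, j ≠ i → b.repr (B (b i)) j = 0 := fun j hj =>
      key (wt i) (B (b i)) hBb j fun h => hj (hwt h)
    have hexp : B (b i) = b.repr (B (b i)) i • b i := by
      conv_lhs => rw [← b.sum_repr (B (b i))]
      rw [Finset.sum_eq_single i (fun j _ hj => by rw [hrepr j hj, zero_smul])
        (fun h => absurd (Finset.mem_univ i) h)]
    -- and the multiplier is `wt i`, since `b i` is then an eigenvector for it
    have ha : wt i = b.repr (B (b i)) i := by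
      by_contra h
      have hmem : b i ∈ B.maxGenEigenspace (b.repr (B (b i)) i) :=
        Module.End.eigenspace_le_maxGenEigenspace (Module.End.mem_eigenspace_iff.mpr hexp)
      have h1 := key _ (b i) hmem i h
      rw [b.repr_self, Finsupp.single_eq_same] at h1
      exact one_ne_zero h1
    rw [hexp, ← ha]
  · by_contra h
    exact hi (key μ x hx i fun h' => h h'.symm)

end Summit.ValiantsHypothesis.ValiantsHypothesis.Theorems.RigidityForcesSymmetryRigidMinimalRepr
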